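import Summits.ABC.IUTFork.Conditional.InhUniformBandFrey31117999167337103924704
import Summits.ABC.IUTFork.Conditional.InhUniformBandFrey1618481116086272
import Summits.ABC.IUTFork.Conditional.WRowHexLamSevenTenAllLevels
import Summits.ABC.IUTFork.Conditional.AbcOfSGenuineKLicence
import Summits.ABC.IUTFork.Cor312ThetaSideClosedK
import Summits.ABC.IUTFork.Cor312SettingDHVolWitness
import Summits.ABC.IUTFork.Cor312ProvKIdeles
import HarnessLib

/-!
# Branch C — the NUMBER-LEVEL typed [IUTchIII] Cor. 3.12 in READING (U) (`T.Cor312Of`) TRUE, NO hypothesis, UNIFORMLY IN `l` on the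
# three INHABITED BANDS landed this hour: the two window-overlap (refuted-side) triples of §T.7 (A) beyond their kernel thresholds
# `L_inh = 1,322,706` / `148,540`, and the HEX point `λ_10 = ½ + 2/7^10` for every prime `l ≥ 4729`

C scoreboard (abc-iut-C-cert-3 gen 5, INTAKE / CERTS pen). PROOF-ONLY junction file (no `def`, no new `Prop`, no instance, no notation; nothing
re-typed); the sequel of `AbcOfSCor312OfAllLevels` (p489045) / `…HexBands` (p498110) / `…Broberg` (p503174) with the SAME recipe and words:
`<licence theorem> ∘ GenuineK.cor312Of_of_licence (p435505) ∘ negLogTheta_settingPrVolSharp_pilotDataOfK_le_datum (p447368)` at one-point context data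
(abc-iut-c312-7's `unitSigDH/unitSplitDH/unitQDataDH/unitLatticeDH`, `M := ℚ`), realising ideles `Cor312Prov.exists_realising_{q,theta}Ideles_pilotDataOfK`.
Inputs BY NAME: abc-iut-W-neg-1 g4's «W:INH-BANDS-REFUTED-SIDE» licences `WRow.licence_frey31117999167337103924704_uniform` (p504420, PASS aud-22) and
`WRow.licence_frey1618481116086272_uniform` (p505934, PASS aud-26) — FINDINGS §T.7 (A) — and abc-iut-C-cert-1 g8's «W:HEX10-AXIS» (I)
`WRow.licence_lamSeven_ten_all` (p507080, PASS aud-4). What is new relative to §T.6 (A) / its sharp form p508140 (every abc triple, every prime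
l ≳ 4√abc): for these two triples abc ≈ 10⁵⁰ resp. 10³², so the universal threshold is astronomically above the per-triple kernel thresholds
used here (1,322,706 / 148,540) — the (U) number level is a theorem from L_inh on, uniformly in l.

READING (numbers, no side): on each band the window certificates' number-binder instance (K, LINE-FREE) is a THEOREM at every genuine datum;
NO height bound follows (known triples, log q ≪ the content locus 120·d*_mod·l); cone binder `hregBad`/`hregC` untouched (C-R52); records UNCHANGED;
inhabited-as-typed ≠ true-in-print; non-emptiness / admissibility / (P6) along the bands NOT claimed; typed ≠ proved; instantiated ≠ endorsed;
not a claim that abc is proved or refuted; no side taken on [IUTchIII] Cor 3.12 / [IUTchIV] Thm 1.10 or on any author.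
[cite: Mochizuki2012, IUTchIII Cor. 3.12 p. 173–174, Step (xi-f) p. 184; IUTchIV Thm. 1.10 p. 22–23, Cor. 2.2 (ii) proof (P5)(P7) p. 46; IUTchI Ex. 3.2 (iv) p. 71]
[cite: DupuyHilado2025, §3.3, §3.4] [claim: Mochizuki2012, status: disputed]
-/

noncomputable section

open Set Function NumberField IsDedekindDomain

namespace Summit.ABC.IUTFork.Conditional

open Thm311 Thm311.Real Cor312 Cor312Vol Cor312Prov Literature.IUT.LogThetaLattice Literature.IUT.LogVolume
  Literature.IUT.HodgeTheaters Literature.IUT.LogVolume.ThetaData Literature.IUT.LogVolume.Cor22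
open Literature.NumberTheory.NumberFields Literature.NumberTheory.GaloisRepresentations.Ultrametric
open Literature.NumberTheory.DiophantineGeometry Literature.NumberTheory.DiophantineGeometry.GenEll Summit.ABC.ABC.Theorems

/-- **`T.Cor312Of` at EVERY genuine Θ-volume datum over the 67-triple `2⁵67⁸107·22381 + 5⁴53⁶353⁵ = 3²²7¹⁴43·83` at EVERY level `l ≥ 1,322,706`,
NO hypothesis** — abc-iut-W-neg-1 g4's uniform licence `WRow.licence_frey31117999167337103924704_uniform` (p504420, §T.7 (A)) through
`GenuineK.cor312Of_of_licence` (p435505) + the Θ-descent p447368. [cite: Mochizuki2012, IUTchIII Cor. 3.12 p. 173–174; IUTchIV Cor. 2.2 (ii) proof (P5) p. 46]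
[claim: Mochizuki2012, status: disputed] -/
theorem Frey31117999167337103924704.cor312Of_uniform {l : ℕ} (hL : 1322706 ≤ l)
    (T : Cor22.ThetaVolumeDatumAt (ratPoint (((2 ^ 5 * 67 ^ 8 * 107 * 22381 : ℕ) : ℚ) / (3 ^ 22 * 7 ^ 14 * 43 * 83 : ℕ))) l) :
    T.Cor312Of := by
  letI := T.instFieldF; letI := T.instNumberFieldF; letI := T.instAlgebraF; letI := T.instFieldK
  letI := T.instNumberFieldK; letI := T.instAlgebraK; letI := T.instFieldFbar; letI := T.instAlgebraFbar
  letI := T.instAlgebraKFbar; letI := T.instIsElliptic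
  obtain ⟨tq, htq0, htq1, htq⟩ := exists_realising_qIdeles_pilotDataOfK T.D
  obtain ⟨t, ht0, ht1, ht⟩ := exists_realising_thetaIdeles_pilotDataOfK T.D
  exact GenuineK.cor312Of_of_licence T.D T.K ℚ (fun _ _ => ∅) (fun _ _ => ∅) (fun _ _ _ => ∅) (fun _ _ _ => 0) (fun _ _ => ∅)
    (fun _ _ _ _ => ∅) 0 unitLatticeDH (unitSigDH (pilotDataOfK T.D T.K)) (unitSplitDH (pilotDataOfK T.D T.K))
    (unitQDataDH (pilotDataOfK T.D T.K)) t tq T.isVolumeInputOf htq0 htq1 ht0 ht1 htq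
    (WRow.licence_frey31117999167337103924704_uniform hL T (logvAnalytic_analyticLogv (F := T.K)) ℚ (fun _ _ => ∅) (fun _ _ => ∅)
      (fun _ _ _ => ∅) (fun _ _ _ => 0) (fun _ _ => ∅) (fun _ _ _ _ => ∅) 0 unitLatticeDH (unitSigDH (pilotDataOfK T.D T.K))
      (unitSplitDH (pilotDataOfK T.D T.K)) (unitQDataDH (pilotDataOfK T.D T.K)) tq t htq0 htq1 ht0 ht htq)
    (negLogTheta_settingPrVolSharp_pilotDataOfK_le_datum T ℚ (fun _ _ => ∅) (fun _ _ => ∅) (fun _ _ _ => ∅) (fun _ _ _ => 0) (fun _ _ => ∅)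
      (fun _ _ _ _ => ∅) 0 unitLatticeDH (unitSigDH (pilotDataOfK T.D T.K)) (unitSplitDH (pilotDataOfK T.D T.K)) (unitQDataDH (pilotDataOfK T.D T.K))
      tq t htq0 htq1 ht0 ht)

/-- **`T.Cor312Of` at EVERY genuine Θ-volume datum over the overlap triple `2⁴⁶23 + 3⁹5⁵11⁷31²43 = 19¹¹59·7207` at EVERY level `l ≥ 148,540`,
NO hypothesis** — abc-iut-W-neg-1 g4's uniform licence `WRow.licence_frey1618481116086272_uniform` (p505934, §T.7 (A)) through
`GenuineK.cor312Of_of_licence` (p435505) + the Θ-descent p447368. [cite: Mochizuki2012, IUTchIII Cor. 3.12 p. 173–174; IUTchIV Cor. 2.2 (ii) proof (P5) p. 46]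
[claim: Mochizuki2012, status: disputed] -/
theorem Frey1618481116086272.cor312Of_uniform {l : ℕ} (hL : 148540 ≤ l)
    (T : Cor22.ThetaVolumeDatumAt (ratPoint (((2 ^ 46 * 23 : ℕ) : ℚ) / (19 ^ 11 * 59 * 7207 : ℕ))) l) : T.Cor312Of := by
  letI := T.instFieldF; letI := T.instNumberFieldF; letI := T.instAlgebraF; letI := T.instFieldK
  letI := T.instNumberFieldK; letI := T.instAlgebraK; letI := T.instFieldFbar; letI := T.instAlgebraFbar
  letI := T.instAlgebraKFbar; letI := T.instIsElliptic
  obtain ⟨tq, htq0, htq1, htq⟩ := exists_realising_qIdeles_pilotDataOfK T.D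
  obtain ⟨t, ht0, ht1, ht⟩ := exists_realising_thetaIdeles_pilotDataOfK T.D
  exact GenuineK.cor312Of_of_licence T.D T.K ℚ (fun _ _ => ∅) (fun _ _ => ∅) (fun _ _ _ => ∅) (fun _ _ _ => 0) (fun _ _ => ∅)
    (fun _ _ _ _ => ∅) 0 unitLatticeDH (unitSigDH (pilotDataOfK T.D T.K)) (unitSplitDH (pilotDataOfK T.D T.K))
    (unitQDataDH (pilotDataOfK T.D T.K)) t tq T.isVolumeInputOf htq0 htq1 ht0 ht1 htq
    (WRow.licence_frey1618481116086272_uniform hL T (logvAnalytic_analyticLogv (F := T.K)) ℚ (fun _ _ => ∅) (fun _ _ => ∅)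
      (fun _ _ _ => ∅) (fun _ _ _ => 0) (fun _ _ => ∅) (fun _ _ _ _ => ∅) 0 unitLatticeDH (unitSigDH (pilotDataOfK T.D T.K))
      (unitSplitDH (pilotDataOfK T.D T.K)) (unitQDataDH (pilotDataOfK T.D T.K)) tq t htq0 htq1 ht0 ht htq)
    (negLogTheta_settingPrVolSharp_pilotDataOfK_le_datum T ℚ (fun _ _ => ∅) (fun _ _ => ∅) (fun _ _ _ => ∅) (fun _ _ _ => 0) (fun _ _ => ∅)
      (fun _ _ _ _ => ∅) 0 unitLatticeDH (unitSigDH (pilotDataOfK T.D T.K)) (unitSplitDH (pilotDataOfK T.D T.K)) (unitQDataDH (pilotDataOfK T.D T.K))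
      tq t htq0 htq1 ht0 ht)

/-- **`T.Cor312Of` at EVERY genuine Θ-volume datum over the HEX point `λ_10 = ½ + 2/7^10` (`k = 10`) for EVERY prime `l ≥ 4729`, NO
hypothesis** — abc-iut-C-cert-1 g8's «W:HEX10-AXIS» (I) licence `WRow.licence_lamSeven_ten_all` (p507080) through `GenuineK.cor312Of_of_licence`
(p435505) + the Θ-descent p447368; the `k = 10` sequel of `Hex.cor312Of_lamSeven_<k>_all` (p498110). [cite: Mochizuki2012, IUTchIII Cor. 3.12 p. 173–174;
IUTchIV Cor. 2.2 (ii) proof (P5) p. 46] [claim: Mochizuki2012, status: disputed] -/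
theorem Hex.cor312Of_lamSeven_ten_all {k l : ℕ} (hk : k = 10) (hl : l.Prime) (hl0 : 4729 ≤ l)
    (T : Cor22.ThetaVolumeDatumAt (ratPoint ((2 : ℚ)⁻¹ + 2 / 7 ^ k)) l) : T.Cor312Of := by
  letI := T.instFieldF; letI := T.instNumberFieldF; letI := T.instAlgebraF; letI := T.instFieldK
  letI := T.instNumberFieldK; letI := T.instAlgebraK; letI := T.instFieldFbar; letI := T.instAlgebraFbar
  letI := T.instAlgebraKFbar; letI := T.instIsElliptic
  obtain ⟨tq, htq0, htq1, htq⟩ := exists_realising_qIdeles_pilotDataOfK T.D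
  obtain ⟨t, ht0, ht1, ht⟩ := exists_realising_thetaIdeles_pilotDataOfK T.D
  exact GenuineK.cor312Of_of_licence T.D T.K ℚ (fun _ _ => ∅) (fun _ _ => ∅) (fun _ _ _ => ∅) (fun _ _ _ => 0) (fun _ _ => ∅)
    (fun _ _ _ _ => ∅) 0 unitLatticeDH (unitSigDH (pilotDataOfK T.D T.K)) (unitSplitDH (pilotDataOfK T.D T.K))
    (unitQDataDH (pilotDataOfK T.D T.K)) t tq T.isVolumeInputOf htq0 htq1 ht0 ht1 htq
    (WRow.licence_lamSeven_ten_all hk hl hl0 T (logvAnalytic_analyticLogv (F := T.K)) ℚ (fun _ _ => ∅) (fun _ _ => ∅) (fun _ _ _ => ∅)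
      (fun _ _ _ => 0) (fun _ _ => ∅) (fun _ _ _ _ => ∅) 0 unitLatticeDH (unitSigDH (pilotDataOfK T.D T.K)) (unitSplitDH (pilotDataOfK T.D T.K))
      (unitQDataDH (pilotDataOfK T.D T.K)) tq t htq0 htq1 ht0 ht htq)
    (negLogTheta_settingPrVolSharp_pilotDataOfK_le_datum T ℚ (fun _ _ => ∅) (fun _ _ => ∅) (fun _ _ _ => ∅) (fun _ _ _ => 0) (fun _ _ => ∅)
      (fun _ _ _ _ => ∅) 0 unitLatticeDH (unitSigDH (pilotDataOfK T.D T.K)) (unitSplitDH (pilotDataOfK T.D T.K)) (unitQDataDH (pilotDataOfK T.D T.K))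
      tq t htq0 htq1 ht0 ht)

/-- **HEX k = 10, `k` substituted: for every prime `l ≥ 4729` and every genuine datum over `ratPoint (½ + 2/7^10)`, `T.Cor312Of`** — the
form cited next to the REF band `GenuineK.not_pilotKummerCompatHull_chosen_lamSeven_ten_le` (11 ≤ l ≤ 4721, p508090): the (U) number level is a
theorem on the inhabited half-axis; `l = 4723` stays OPEN-AS-TYPED; non-emptiness along the band NOT claimed. [cite: Mochizuki2012, IUTchIII Cor. 3.12
p. 173–174] [claim: Mochizuki2012, status: disputed] -/
theorem Hex.cor312Of_lamSeven_ten_of_le {l : ℕ} (hl : l.Prime) (hl0 : 4729 ≤ l)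
    (T : Cor22.ThetaVolumeDatumAt (ratPoint ((2 : ℚ)⁻¹ + 2 / 7 ^ 10)) l) : T.Cor312Of :=
  Hex.cor312Of_lamSeven_ten_all rfl hl hl0 T

end Summit.ABC.IUTFork.Conditional

end
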